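import Mathlib
import HarnessLib
import Literature.MathematicalPhysics.QuantumFieldTheory.Balaban1983to89.B13Contraction113
import Literature.MathematicalPhysics.QuantumFieldTheory.Balaban1983to89.B12Lineariz267
import Literature.MathematicalPhysics.QuantumFieldTheory.Balaban1983to89.B12LinearizAnalytic267
import Literature.MathematicalPhysics.QuantumFieldTheory.Balaban1983to89.MatrixLog
import Literature.MathematicalPhysics.QuantumFieldTheory.Balaban1983to89.B12JacobianTrLog268
import Literature.MathematicalPhysics.QuantumFieldTheory.Balaban1983to89.B12JacobianReal267

/-!
# B12 [Balaban1987RG1] (2.12) p. 268 — the term «Tr log(I − h((δ/δB)D̃)(g_kCB))» at REAL fields: the operator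
# logarithm `log DΦ(B) = mlog (1 − J(B))` commutes with the conjugation, its trace is REAL, and
# `Tr log DΦ(B₀) = log det DΦ(B₀)` ON THE NOSE (the real logarithm of the positive Jacobian) at every real point
# `B₀` of the small-field ball

CITATION. T. Bałaban, *Renormalization group approach to lattice gauge field theories. I. Generation of effective
actions in a small field approximation and a coupling constant renormalization in four dimensions*, Commun. Math.
Phys. 109 (1987) 249–301 [Balaban1987RG1] ("B12" of the cell), (2.12) p. 268 (render `…1987-cmp109-rg-I-small-field
-p020`; PDF page = journal page − 248), with p. 267 (`-p019`).  This file sits on top of the tree leaves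
`B12JacobianTrLog268` (the operator `log DΦ(B) := mlog (1 − J(B))`, `J(B) = h∘DD̃(B)`, `‖J(B)‖ < 1`, and in finite
dimension `exp (Tr log DΦ(B)) = det DΦ(B)`) and `B12JacobianReal267` (the real structure: conjugations `κ_𝒳`, `κ_𝒴`;
`J(B₀)` commutes with `κ_𝒴` at a real point; `det DΦ(B₀)` is real and positive there; the generic fact that an
operator commuting with an additive antilinear involution has real trace), and on the cell's `MatrixLog` (the series
`mlog X = Σ logSeriesCoeff n • (X − 1)ⁿ`, `hasSum_mlog`); all are imported and used BY NAME, nothing is re-derived.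

THE PRINT (verbatim).  B12 p. 267 [PDF 19]: *«At first we introduce an operator h. It transforms 𝐠-valued functions
B defined at bonds of the lattice T⁽ᵏ⁺¹⁾ into such functions defined at bonds of T⁽ᵏ⁾.»* … *«We are looking for an
analytic, 𝐠-valued function D̃(B′), defined at bonds of T⁽ᵏ⁺¹⁾, and such that the transformation B′ = B − hD̃(B)
linearizes the function Q̃(B′).»* … *«The above change of variables yields the integral with the δ-function
δ(Q̃B).»*; the substitution is made in the real integral (2.10) *«(2.1) = logN_k′⁻¹ ∫ dB′σ(B′)δ(Q̃(B′)) × χ_k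
exp[…]»* and its Jacobian is written in the new action (2.12) p. 268 [PDF 20] directly as the term
*«Tr log(I − h((δ/δB)D̃)(g_kCB))»* inside the exponent (the print evaluates the term at the field `g_kCB`; below
this evaluation point is the abstract real point `B₀` of the ball).  READING: writing the Jacobian of a substitution in a REAL
integral as `exp[Tr log DΦ]` presupposes that `Tr log DΦ` is the honest (real) logarithm of the (positive) Jacobian
determinant `det DΦ`, not merely one of its complex logarithms.  `B12JacobianTrLog268` typed the term and proved
`exp (Tr log DΦ(B)) = det DΦ(B)` — which determines `Tr log DΦ(B)` only modulo `2πiℤ` — and recorded the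
identification of `Tr log DΦ` with a logarithm of `det DΦ` as NOT TYPED; `B12JacobianReal267` proved `det DΦ(B₀)`
real and positive at real `B₀` and its principal logarithm real, and recorded the reality of the OPERATOR-level
`Tr log DΦ(B₀)` itself as NOT TYPED.  This file closes both items.

THE TYPING (schematic, exactly as in the leaves below this one — cell DIVERGENCE row for this file).  `𝒴`, `𝒳`
complex Banach spaces; `hop : 𝒳 →ₗ[ℂ] 𝒴` (print's `h`) with `‖hop X‖ ≤ b‖X‖`; `Ct : 𝒴 → 𝒳` (print's `C̃`) with
`QuadAnalytic Ct C₂ R` and `AnalyticOnNhd ℂ Ct {‖Y‖ < R}`; smallness `9C₂bε ≤ 1/2` (the regime in which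
`B12JacobianTrLog268` proves `‖J(B)‖ < 1`), `3ε ≤ R`; `D̃` HYPOTHESIS-STYLE: any `Dt : 𝒴 → 𝒳` with
`Dt B ∈ closedBall 0 (4C₂ε²)` and `Ct (B − hop (Dt B)) = Dt B` on `‖B‖ < ε`; the REAL STRUCTURE («𝐠-valued») as in
`B12JacobianReal267`: conjugations `κX : 𝒳 ≃ₗᵢ⋆[ℂ] 𝒳`, `κY : 𝒴 ≃ₗᵢ⋆[ℂ] 𝒴` with `κ (κ v) = v`, equivariance
`hop (κX X) = κY (hop X)`, `Ct (κY Y) = κX (Ct Y)` on `‖Y‖ < R`, real fields `κY B₀ = B₀`.  The Jacobian operator is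
`J(B₀) := hop.mkContinuous b hHop ∘L fderiv ℂ Dt B₀`, `DΦ(B₀) = 1 − J(B₀)`, `log DΦ(B₀) := mlog (1 − J(B₀))`, and
(finite dimension) `Tr` = `LinearMap.trace ℂ 𝒴`, `det` = `LinearMap.det`, all exactly as in `B12JacobianTrLog268`.

CONTENT.  §1 [folklore] GENERIC: the logarithmic series has REAL coefficients
(`starRingEnd ℂ (logSeriesCoeff n) = logSeriesCoeff n`); an operator `S` commuting with a conjugation `κ`
(`S (κ v) = κ (S v)`) has commuting powers, negative and real multiples; hence for `‖J‖ < 1` with `J` commuting with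
`κ` the operator logarithm `mlog (1 − J) = Σₙ logSeriesCoeff n • (−J)ⁿ` (`MatrixLog.hasSum_mlog`) COMMUTES WITH `κ`
(`mlog_one_sub_apply_conj` — the series mapped through evaluation at `κ v` and through `S ↦ κ (S v)`, which is
additive and continuous, and uniqueness of limits), and in finite dimension its trace is REAL
(`conj_trace_mlog_one_sub`, by `B12JacobianReal267.conj_trace_eq`).  §2 [folklore] AT A REAL POINT `B₀` of the
ball: `log DΦ(B₀)` commutes with `κ_𝒴` (`logJacobian_real`, from `B12JacobianReal267.jacobianOp_real` and
`B12JacobianTrLog268.norm_jacobianOp_lt_one`); in finite dimension `Tr log DΦ(B₀)` is REAL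
(`conj_trace_logJacobian`, `trace_logJacobian_im_eq_zero`, `trace_logJacobian_eq_ofReal_re`), and THE
IDENTIFICATION: from `exp (Tr log DΦ(B₀)) = det DΦ(B₀)` (`B12JacobianTrLog268.cexp_trace_logJacobian_eq_det_fderiv_phi`),
the reality of `Tr log DΦ(B₀)` and `det DΦ(B₀) = r > 0` (`B12JacobianReal267.det_jacobian_pos`), injectivity of the
REAL exponential gives `Re Tr log DΦ(B₀) = Real.log (Re det DΦ(B₀))` (`re_trace_logJacobian_eq_log_det`), hence
`Tr log DΦ(B₀) = ((Real.log (Re det DΦ(B₀)) : ℝ) : ℂ) = Complex.log (det DΦ(B₀))` (`trace_logJacobian_eq_ofReal_log_det`,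
`trace_logJacobian_eq_clog_det`) and `Re det DΦ(B₀) = Real.exp (Re Tr log DΦ(B₀))` (`re_det_jacobian_eq_exp`): at real
fields the (2.12) term IS the logarithm of the positive Jacobian of the substitution in (2.10), with no `2πiℤ`
ambiguity and no absolute value.  §3 a transcription theorem [cite] and a degenerate model (`𝒳 = 𝒴 = ℂ`, `κ` = complex
conjugation, `J = 0`) showing the hypotheses are jointly satisfiable.  NOT TYPED: the same identification at
NON-real `B` (there `Tr log DΦ(B)` and `Complex.log (det DΦ(B))` can differ by `2πik` once `|Im Tr log DΦ(B)| ≥ π`,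
which the schematic bounds do not exclude uniformly in the dimension), the concrete `𝔰𝔲(n)` lattice real structure,
the lattice formula of `h`, the measure-theoretic change of variables in (2.10).  Everything is [folklore] except §3;
nothing of [B12] is asserted; NOT summit progress.
v1.1 (docstring-only, same 18 theorems + 1 example, proofs byte-identical to v1 p189303): PRIOR ART in the tree
recorded (cross-read finding, reader outside the lineage): §1's `conj_logSeriesCoeff` is STATEMENT-IDENTICAL to the
parent-namespace theorem `Literature.MathematicalPhysics.QuantumFieldTheory.Balaban1983to89.conj_logSeriesCoeff` of
`BlockAveragingFederbushGValued.lean`, and `mlog_one_sub_apply_conj` has the matrix special case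
`Literature.MathematicalPhysics.QuantumFieldTheory.Balaban1983to89.conjEntry_mlog` there (the logarithm (21) of an
entrywise-real matrix is entrywise real — the same real-coefficients ∕ `HasSum.unique` mechanism); that module is
not imported here (it carries the whole block-averaging development of [Balaban1985Averaging]; the one-line
coefficient lemma is kept local rather than importing it), so nothing is re-derived from an import; plus one
clause on the print's evaluation point `g_kCB`.
-/

open Metric Set Filter Topology
open Literature.Analysis.Complex (logOnePlus logSeriesCoeff)

namespace Literature.MathematicalPhysics.QuantumFieldTheory.Balaban1983to89.B12TrLogReal268

open Literature.MathematicalPhysics.QuantumFieldTheory.Balaban1983to89.B13Contraction113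
open Literature.MathematicalPhysics.QuantumFieldTheory.Balaban1983to89.B12Lineariz267
open Literature.MathematicalPhysics.QuantumFieldTheory.Balaban1983to89.MatrixLog
open Literature.MathematicalPhysics.QuantumFieldTheory.Balaban1983to89.B12JacobianTrLog268
open Literature.MathematicalPhysics.QuantumFieldTheory.Balaban1983to89.B12JacobianReal267

/-! ## §1  The operator logarithm commutes with a conjugation; its trace is real -/
section generic

variable {𝒴 : Type*} [NormedAddCommGroup 𝒴] [NormedSpace ℂ 𝒴]

/-- **The logarithmic series has real coefficients**: `conj ((−1)ⁿ⁺¹/n) = (−1)ⁿ⁺¹/n`.  DUPLICATE (statement-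
identical) of the parent-namespace tree theorem `Balaban1983to89.conj_logSeriesCoeff`
(`BlockAveragingFederbushGValued.lean`), kept local only because that module is not imported here. [folklore] -/
theorem conj_logSeriesCoeff (n : ℕ) : starRingEnd ℂ (logSeriesCoeff n) = logSeriesCoeff n := by
  simp [Literature.Analysis.Complex.logSeriesCoeff, map_div₀, map_pow, map_neg, map_one, map_natCast]

/-- Powers of an operator commuting with `κ` commute with `κ`. [folklore] -/
theorem pow_apply_conj (κ : 𝒴 ≃ₗᵢ⋆[ℂ] 𝒴) {S : 𝒴 →L[ℂ] 𝒴} (hS : ∀ v, S (κ v) = κ (S v)) (n : ℕ) (v : 𝒴) :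
    (S ^ n) (κ v) = κ ((S ^ n) v) := by
  induction n generalizing v with
  | zero => simp
  | succ n ih =>
      rw [pow_succ']
      change S ((S ^ n) (κ v)) = κ (S ((S ^ n) v))
      rw [ih, hS]

/-- The negative of an operator commuting with `κ` commutes with `κ` (`κ` is additive). [folklore] -/
theorem neg_apply_conj (κ : 𝒴 ≃ₗᵢ⋆[ℂ] 𝒴) {S : 𝒴 →L[ℂ] 𝒴} (hS : ∀ v, S (κ v) = κ (S v)) (v : 𝒴) :
    (-S) (κ v) = κ ((-S) v) := by
  rw [neg_apply, neg_apply, hS, map_neg]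

/-- A REAL multiple (`conj c = c`) of an operator commuting with `κ` commutes with `κ` (`κ` is antilinear:
`κ (c • w) = conj c • κ w`). [folklore] -/
theorem smul_apply_conj (κ : 𝒴 ≃ₗᵢ⋆[ℂ] 𝒴) {S : 𝒴 →L[ℂ] 𝒴} (hS : ∀ v, S (κ v) = κ (S v)) {c : ℂ}
    (hc : starRingEnd ℂ c = c) (v : 𝒴) :
    (c • S) (κ v) = κ ((c • S) v) := by
  rw [smul_apply, smul_apply, hS, κ.map_smulₛₗ, hc]

/-- The terms of the logarithmic series of `1 − J` commute with `κ` when `J` does. [folklore] -/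
theorem logSeries_term_apply_conj (κ : 𝒴 ≃ₗᵢ⋆[ℂ] 𝒴) {J : 𝒴 →L[ℂ] 𝒴} (hJκ : ∀ v, J (κ v) = κ (J v))
    (n : ℕ) (v : 𝒴) :
    (logSeriesCoeff n • (-J) ^ n) (κ v) = κ ((logSeriesCoeff n • (-J) ^ n) v) :=
  smul_apply_conj κ (pow_apply_conj κ (neg_apply_conj κ hJκ) n) (conj_logSeriesCoeff n) v

variable [CompleteSpace 𝒴]

/-- **The operator logarithm `log (1 − J) = mlog (1 − J)` COMMUTES WITH THE CONJUGATION** when `‖J‖ < 1` and `J`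
commutes with `κ`: `mlog (1 − J) (κ v) = κ (mlog (1 − J) v)`.  PRIOR ART (tree, matrix special case):
`Balaban1983to89.conjEntry_mlog` (`BlockAveragingFederbushGValued.lean`: `mlog` of an entrywise-real matrix with
`‖A − 1‖ < 1` is entrywise real), by the same mechanism.  Proof:
`mlog (1 − J) = Σₙ logSeriesCoeff n • (−J)ⁿ` (`MatrixLog.hasSum_mlog`); map the series through the continuous linear
evaluation at `κ v` and through the continuous additive map `S ↦ κ (S v)`; the two resulting `𝒴`-valued series
have the same terms (`logSeries_term_apply_conj`), so their sums agree. [folklore] -/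
theorem mlog_one_sub_apply_conj (κ : 𝒴 ≃ₗᵢ⋆[ℂ] 𝒴) {J : 𝒴 →L[ℂ] 𝒴} (hJ : ‖J‖ < 1)
    (hJκ : ∀ v, J (κ v) = κ (J v)) (v : 𝒴) :
    (mlog (1 - J)) (κ v) = κ ((mlog (1 - J)) v) := by
  have hX : ‖(1 - J : 𝒴 →L[ℂ] 𝒴) - 1‖ < 1 := by rwa [sub_sub_cancel_left, norm_neg]
  have hs := hasSum_mlog hX
  rw [sub_sub_cancel_left] at hs
  have h1 : HasSum (fun n : ℕ => (logSeriesCoeff n • (-J) ^ n) (κ v)) ((mlog (1 - J)) (κ v)) := by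
    have := hs.map (ContinuousLinearMap.apply ℂ 𝒴 (κ v)) (ContinuousLinearMap.apply ℂ 𝒴 (κ v)).continuous
    simpa [Function.comp_def] using this
  let g : (𝒴 →L[ℂ] 𝒴) →+ 𝒴 := AddMonoidHom.mk' (fun S => κ (S v)) (fun S T => by simp [map_add])
  have hg : Continuous g := κ.continuous.comp (ContinuousLinearMap.apply ℂ 𝒴 v).continuous
  have h2 : HasSum (fun n : ℕ => κ ((logSeriesCoeff n • (-J) ^ n) v)) (κ ((mlog (1 - J)) v)) := by
    have := hs.map g hg
    simpa [g, Function.comp_def] using this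
  have heq : (fun n : ℕ => (logSeriesCoeff n • (-J) ^ n) (κ v)) =
      fun n : ℕ => κ ((logSeriesCoeff n • (-J) ^ n) v) :=
    funext fun n => logSeries_term_apply_conj κ hJκ n v
  rw [heq] at h1
  exact h1.unique h2

/-- **In finite dimension the trace of `log (1 − J)` is REAL** when `‖J‖ < 1` and `J` commutes with an involutive
conjugation `κ`: `conj (Tr mlog (1 − J)) = Tr mlog (1 − J)` (`B12JacobianReal267.conj_trace_eq` applied to the
`κ`-commuting operator `mlog (1 − J)`). [folklore] -/
theorem conj_trace_mlog_one_sub [FiniteDimensional ℂ 𝒴] (κ : 𝒴 ≃ₗᵢ⋆[ℂ] 𝒴) (hκ : ∀ v, κ (κ v) = v)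
    {J : 𝒴 →L[ℂ] 𝒴} (hJ : ‖J‖ < 1) (hJκ : ∀ v, J (κ v) = κ (J v)) :
    starRingEnd ℂ (LinearMap.trace ℂ 𝒴 ((mlog (1 - J) : 𝒴 →L[ℂ] 𝒴) : 𝒴 →ₗ[ℂ] 𝒴)) =
      LinearMap.trace ℂ 𝒴 ((mlog (1 - J) : 𝒴 →L[ℂ] 𝒴) : 𝒴 →ₗ[ℂ] 𝒴) :=
  conj_trace_eq κ (map_add κ) κ.map_smulₛₗ hκ _ fun v => by
    rw [ContinuousLinearMap.coe_coe]
    exact mlog_one_sub_apply_conj κ hJ hJκ v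

/-- The imaginary part of `Tr mlog (1 − J)` vanishes (same hypotheses). [folklore] -/
theorem trace_mlog_one_sub_im_eq_zero [FiniteDimensional ℂ 𝒴] (κ : 𝒴 ≃ₗᵢ⋆[ℂ] 𝒴) (hκ : ∀ v, κ (κ v) = v)
    {J : 𝒴 →L[ℂ] 𝒴} (hJ : ‖J‖ < 1) (hJκ : ∀ v, J (κ v) = κ (J v)) :
    (LinearMap.trace ℂ 𝒴 ((mlog (1 - J) : 𝒴 →L[ℂ] 𝒴) : 𝒴 →ₗ[ℂ] 𝒴)).im = 0 :=
  Complex.conj_eq_iff_im.mp (conj_trace_mlog_one_sub κ hκ hJ hJκ)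

/-- **Generic identification**: if `exp t = d` in `ℂ` with `t` real (`t.im = 0`) and `d` real (`d = r`; then
necessarily `r = Real.exp (Re t) > 0`), then `t = Real.log r` — injectivity of the REAL exponential removes the
`2πiℤ` ambiguity of the complex logarithm. [folklore] -/
theorem eq_log_of_exp_eq_of_im_eq_zero {t d : ℂ} {r : ℝ} (hexp : Complex.exp t = d) (ht : t.im = 0)
    (hd : d = (r : ℂ)) : t = ((Real.log r : ℝ) : ℂ) := by
  have htre : t = ((t.re : ℝ) : ℂ) := (Complex.conj_eq_iff_re.mp (Complex.conj_eq_iff_im.mpr ht)).symm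
  have h1 : ((Real.exp t.re : ℝ) : ℂ) = (r : ℂ) := by
    rw [Complex.ofReal_exp, ← htre, hexp, hd]
  have h2 : Real.exp t.re = r := Complex.ofReal_injective h1
  rw [htre, ← h2, Real.log_exp]

end generic

/-! ## §2  At a real point of the ball: `log DΦ(B₀)` commutes with the conjugation, `Tr log DΦ(B₀)` is real and
equals `log det DΦ(B₀)` -/
section jacobian

variable {𝒳 𝒴 : Type*} [NormedAddCommGroup 𝒳] [NormedSpace ℂ 𝒳] [CompleteSpace 𝒳]
  [NormedAddCommGroup 𝒴] [NormedSpace ℂ 𝒴] [CompleteSpace 𝒴]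
  {hop : 𝒳 →ₗ[ℂ] 𝒴} {Ct : 𝒴 → 𝒳} {C₂ R b ε : ℝ} {Dt : 𝒴 → 𝒳}
  {κX : 𝒳 ≃ₗᵢ⋆[ℂ] 𝒳} {κY : 𝒴 ≃ₗᵢ⋆[ℂ] 𝒴}

/-- **`log DΦ(B₀) = mlog (1 − J(B₀))` COMMUTES WITH THE CONJUGATION at a real point** `κB₀ = B₀`, `‖B₀‖ < ε`
(`9C₂bε ≤ 1/2`): `J(B₀)` commutes with `κ_𝒴` (`B12JacobianReal267.jacobianOp_real`) and `‖J(B₀)‖ < 1`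
(`B12JacobianTrLog268.norm_jacobianOp_lt_one`), so §1 applies. [folklore] -/
theorem logJacobian_real (hC : QuadAnalytic Ct C₂ R) (hCa : AnalyticOnNhd ℂ Ct {Y : 𝒴 | ‖Y‖ < R})
    (hC₂ : 0 ≤ C₂) (hb : 0 ≤ b) (hHop : ∀ X, ‖hop X‖ ≤ b * ‖X‖) (hq2 : 9 * C₂ * b * ε ≤ 1 / 2)
    (hRC : 3 * ε ≤ R) (hDball : ∀ B : 𝒴, ‖B‖ < ε → Dt B ∈ closedBall (0:𝒳) (4 * C₂ * ε ^ 2))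
    (hDfix : ∀ B : 𝒴, ‖B‖ < ε → Ct (B - hop (Dt B)) = Dt B)
    (hκX : ∀ X, κX (κX X) = X) (hκY : ∀ B, κY (κY B) = B)
    (hhop : ∀ X, hop (κX X) = κY (hop X)) (hCt : ∀ Y : 𝒴, ‖Y‖ < R → Ct (κY Y) = κX (Ct Y))
    {B₀ : 𝒴} (hB₀ : ‖B₀‖ < ε) (hreal : κY B₀ = B₀) (v : 𝒴) :
    (mlog (1 - hop.mkContinuous b hHop ∘L fderiv ℂ Dt B₀)) (κY v) =
      κY ((mlog (1 - hop.mkContinuous b hHop ∘L fderiv ℂ Dt B₀)) v) :=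
  mlog_one_sub_apply_conj κY (norm_jacobianOp_lt_one hC hCa hC₂ hb hHop hq2 hRC hDball hDfix hB₀)
    (jacobianOp_real hC hCa hC₂ hb hHop (lt_one_of_le_half hq2) hRC hDball hDfix hκX hκY hhop hCt hB₀ hreal) v

variable [FiniteDimensional ℂ 𝒴]

/-- **`Tr log DΦ(B₀)` IS REAL at a real point**: `conj (Tr log DΦ(B₀)) = Tr log DΦ(B₀)`. [folklore] -/
theorem conj_trace_logJacobian (hC : QuadAnalytic Ct C₂ R) (hCa : AnalyticOnNhd ℂ Ct {Y : 𝒴 | ‖Y‖ < R})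
    (hC₂ : 0 ≤ C₂) (hb : 0 ≤ b) (hHop : ∀ X, ‖hop X‖ ≤ b * ‖X‖) (hq2 : 9 * C₂ * b * ε ≤ 1 / 2)
    (hRC : 3 * ε ≤ R) (hDball : ∀ B : 𝒴, ‖B‖ < ε → Dt B ∈ closedBall (0:𝒳) (4 * C₂ * ε ^ 2))
    (hDfix : ∀ B : 𝒴, ‖B‖ < ε → Ct (B - hop (Dt B)) = Dt B)
    (hκX : ∀ X, κX (κX X) = X) (hκY : ∀ B, κY (κY B) = B)
    (hhop : ∀ X, hop (κX X) = κY (hop X)) (hCt : ∀ Y : 𝒴, ‖Y‖ < R → Ct (κY Y) = κX (Ct Y))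
    {B₀ : 𝒴} (hB₀ : ‖B₀‖ < ε) (hreal : κY B₀ = B₀) :
    starRingEnd ℂ (LinearMap.trace ℂ 𝒴
        ((mlog (1 - hop.mkContinuous b hHop ∘L fderiv ℂ Dt B₀) : 𝒴 →L[ℂ] 𝒴) : 𝒴 →ₗ[ℂ] 𝒴)) =
      LinearMap.trace ℂ 𝒴 ((mlog (1 - hop.mkContinuous b hHop ∘L fderiv ℂ Dt B₀) : 𝒴 →L[ℂ] 𝒴) : 𝒴 →ₗ[ℂ] 𝒴) :=
  conj_trace_mlog_one_sub κY hκY (norm_jacobianOp_lt_one hC hCa hC₂ hb hHop hq2 hRC hDball hDfix hB₀)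
    (jacobianOp_real hC hCa hC₂ hb hHop (lt_one_of_le_half hq2) hRC hDball hDfix hκX hκY hhop hCt hB₀ hreal)

/-- `Im Tr log DΦ(B₀) = 0` at a real point. [folklore] -/
theorem trace_logJacobian_im_eq_zero (hC : QuadAnalytic Ct C₂ R) (hCa : AnalyticOnNhd ℂ Ct {Y : 𝒴 | ‖Y‖ < R})
    (hC₂ : 0 ≤ C₂) (hb : 0 ≤ b) (hHop : ∀ X, ‖hop X‖ ≤ b * ‖X‖) (hq2 : 9 * C₂ * b * ε ≤ 1 / 2)
    (hRC : 3 * ε ≤ R) (hDball : ∀ B : 𝒴, ‖B‖ < ε → Dt B ∈ closedBall (0:𝒳) (4 * C₂ * ε ^ 2))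
    (hDfix : ∀ B : 𝒴, ‖B‖ < ε → Ct (B - hop (Dt B)) = Dt B)
    (hκX : ∀ X, κX (κX X) = X) (hκY : ∀ B, κY (κY B) = B)
    (hhop : ∀ X, hop (κX X) = κY (hop X)) (hCt : ∀ Y : 𝒴, ‖Y‖ < R → Ct (κY Y) = κX (Ct Y))
    {B₀ : 𝒴} (hB₀ : ‖B₀‖ < ε) (hreal : κY B₀ = B₀) :
    (LinearMap.trace ℂ 𝒴
        ((mlog (1 - hop.mkContinuous b hHop ∘L fderiv ℂ Dt B₀) : 𝒴 →L[ℂ] 𝒴) : 𝒴 →ₗ[ℂ] 𝒴)).im = 0 :=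
  Complex.conj_eq_iff_im.mp
    (conj_trace_logJacobian hC hCa hC₂ hb hHop hq2 hRC hDball hDfix hκX hκY hhop hCt hB₀ hreal)

/-- `Tr log DΦ(B₀) = Re Tr log DΦ(B₀)` (as a complex number) at a real point. [folklore] -/
theorem trace_logJacobian_eq_ofReal_re (hC : QuadAnalytic Ct C₂ R) (hCa : AnalyticOnNhd ℂ Ct {Y : 𝒴 | ‖Y‖ < R})
    (hC₂ : 0 ≤ C₂) (hb : 0 ≤ b) (hHop : ∀ X, ‖hop X‖ ≤ b * ‖X‖) (hq2 : 9 * C₂ * b * ε ≤ 1 / 2)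
    (hRC : 3 * ε ≤ R) (hDball : ∀ B : 𝒴, ‖B‖ < ε → Dt B ∈ closedBall (0:𝒳) (4 * C₂ * ε ^ 2))
    (hDfix : ∀ B : 𝒴, ‖B‖ < ε → Ct (B - hop (Dt B)) = Dt B)
    (hκX : ∀ X, κX (κX X) = X) (hκY : ∀ B, κY (κY B) = B)
    (hhop : ∀ X, hop (κX X) = κY (hop X)) (hCt : ∀ Y : 𝒴, ‖Y‖ < R → Ct (κY Y) = κX (Ct Y))
    {B₀ : 𝒴} (hB₀ : ‖B₀‖ < ε) (hreal : κY B₀ = B₀) :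
    LinearMap.trace ℂ 𝒴 ((mlog (1 - hop.mkContinuous b hHop ∘L fderiv ℂ Dt B₀) : 𝒴 →L[ℂ] 𝒴) : 𝒴 →ₗ[ℂ] 𝒴) =
      (((LinearMap.trace ℂ 𝒴
        ((mlog (1 - hop.mkContinuous b hHop ∘L fderiv ℂ Dt B₀) : 𝒴 →L[ℂ] 𝒴) : 𝒴 →ₗ[ℂ] 𝒴)).re : ℝ) : ℂ) :=
  (Complex.conj_eq_iff_re.mp
    (conj_trace_logJacobian hC hCa hC₂ hb hHop hq2 hRC hDball hDfix hκX hκY hhop hCt hB₀ hreal)).symm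

/-- **THE IDENTIFICATION `Tr log DΦ(B₀) = log det DΦ(B₀)` at a real point**, real-logarithm form:
`Tr log DΦ(B₀) = ((Real.log (Re det DΦ(B₀)) : ℝ) : ℂ)`.  From `exp (Tr log DΦ(B₀)) = det DΦ(B₀)`
(`B12JacobianTrLog268.cexp_trace_logJacobian_eq_det_fderiv_phi`), `Tr log DΦ(B₀)` real (above) and
`det DΦ(B₀) = Re det DΦ(B₀)` real (`B12JacobianReal267.det_jacobian_eq_ofReal_re`), by injectivity of the real
exponential (§1 `eq_log_of_exp_eq_of_im_eq_zero`; positivity of `det DΦ(B₀)` is then automatic, and agrees with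
`B12JacobianReal267.det_jacobian_pos`). [folklore] -/
theorem trace_logJacobian_eq_ofReal_log_det (hC : QuadAnalytic Ct C₂ R)
    (hCa : AnalyticOnNhd ℂ Ct {Y : 𝒴 | ‖Y‖ < R})
    (hC₂ : 0 ≤ C₂) (hb : 0 ≤ b) (hHop : ∀ X, ‖hop X‖ ≤ b * ‖X‖) (hq2 : 9 * C₂ * b * ε ≤ 1 / 2)
    (hRC : 3 * ε ≤ R) (hDball : ∀ B : 𝒴, ‖B‖ < ε → Dt B ∈ closedBall (0:𝒳) (4 * C₂ * ε ^ 2))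
    (hDfix : ∀ B : 𝒴, ‖B‖ < ε → Ct (B - hop (Dt B)) = Dt B)
    (hκX : ∀ X, κX (κX X) = X) (hκY : ∀ B, κY (κY B) = B)
    (hhop : ∀ X, hop (κX X) = κY (hop X)) (hCt : ∀ Y : 𝒴, ‖Y‖ < R → Ct (κY Y) = κX (Ct Y))
    {B₀ : 𝒴} (hB₀ : ‖B₀‖ < ε) (hreal : κY B₀ = B₀) :
    LinearMap.trace ℂ 𝒴 ((mlog (1 - hop.mkContinuous b hHop ∘L fderiv ℂ Dt B₀) : 𝒴 →L[ℂ] 𝒴) : 𝒴 →ₗ[ℂ] 𝒴) =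
      ((Real.log (LinearMap.det
        ((fderiv ℂ (fun B => B - hop (Dt B)) B₀ : 𝒴 →L[ℂ] 𝒴) : 𝒴 →ₗ[ℂ] 𝒴)).re : ℝ) : ℂ) :=
  eq_log_of_exp_eq_of_im_eq_zero
    (cexp_trace_logJacobian_eq_det_fderiv_phi hC hCa hC₂ hb hHop hq2 hRC hDball hDfix hB₀)
    (trace_logJacobian_im_eq_zero hC hCa hC₂ hb hHop hq2 hRC hDball hDfix hκX hκY hhop hCt hB₀ hreal)
    (det_jacobian_eq_ofReal_re hC hCa hC₂ hb hHop (lt_one_of_le_half hq2) hRC hDball hDfix hκX hκY hhop hCt hB₀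
      hreal)

/-- **`Tr log DΦ(B₀) = Complex.log (det DΦ(B₀))`** (principal branch) at a real point — the (2.12) term IS the
logarithm of the Jacobian determinant, on the nose (`B12JacobianReal267.log_det_jacobian_eq_ofReal`). [folklore] -/
theorem trace_logJacobian_eq_clog_det (hC : QuadAnalytic Ct C₂ R) (hCa : AnalyticOnNhd ℂ Ct {Y : 𝒴 | ‖Y‖ < R})
    (hC₂ : 0 ≤ C₂) (hb : 0 ≤ b) (hHop : ∀ X, ‖hop X‖ ≤ b * ‖X‖) (hq2 : 9 * C₂ * b * ε ≤ 1 / 2)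
    (hRC : 3 * ε ≤ R) (hDball : ∀ B : 𝒴, ‖B‖ < ε → Dt B ∈ closedBall (0:𝒳) (4 * C₂ * ε ^ 2))
    (hDfix : ∀ B : 𝒴, ‖B‖ < ε → Ct (B - hop (Dt B)) = Dt B)
    (hκX : ∀ X, κX (κX X) = X) (hκY : ∀ B, κY (κY B) = B)
    (hhop : ∀ X, hop (κX X) = κY (hop X)) (hCt : ∀ Y : 𝒴, ‖Y‖ < R → Ct (κY Y) = κX (Ct Y))
    {B₀ : 𝒴} (hB₀ : ‖B₀‖ < ε) (hreal : κY B₀ = B₀) :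
    LinearMap.trace ℂ 𝒴 ((mlog (1 - hop.mkContinuous b hHop ∘L fderiv ℂ Dt B₀) : 𝒴 →L[ℂ] 𝒴) : 𝒴 →ₗ[ℂ] 𝒴) =
      Complex.log (LinearMap.det ((fderiv ℂ (fun B => B - hop (Dt B)) B₀ : 𝒴 →L[ℂ] 𝒴) : 𝒴 →ₗ[ℂ] 𝒴)) := by
  rw [trace_logJacobian_eq_ofReal_log_det hC hCa hC₂ hb hHop hq2 hRC hDball hDfix hκX hκY hhop hCt hB₀ hreal,
    log_det_jacobian_eq_ofReal hC hCa hC₂ hb hHop hq2 hRC hDball hDfix hκX hκY hhop hCt hB₀ hreal]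

/-- **`Re Tr log DΦ(B₀) = Real.log (Re det DΦ(B₀))`** — the real form. [folklore] -/
theorem re_trace_logJacobian_eq_log_det (hC : QuadAnalytic Ct C₂ R) (hCa : AnalyticOnNhd ℂ Ct {Y : 𝒴 | ‖Y‖ < R})
    (hC₂ : 0 ≤ C₂) (hb : 0 ≤ b) (hHop : ∀ X, ‖hop X‖ ≤ b * ‖X‖) (hq2 : 9 * C₂ * b * ε ≤ 1 / 2)
    (hRC : 3 * ε ≤ R) (hDball : ∀ B : 𝒴, ‖B‖ < ε → Dt B ∈ closedBall (0:𝒳) (4 * C₂ * ε ^ 2))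
    (hDfix : ∀ B : 𝒴, ‖B‖ < ε → Ct (B - hop (Dt B)) = Dt B)
    (hκX : ∀ X, κX (κX X) = X) (hκY : ∀ B, κY (κY B) = B)
    (hhop : ∀ X, hop (κX X) = κY (hop X)) (hCt : ∀ Y : 𝒴, ‖Y‖ < R → Ct (κY Y) = κX (Ct Y))
    {B₀ : 𝒴} (hB₀ : ‖B₀‖ < ε) (hreal : κY B₀ = B₀) :
    (LinearMap.trace ℂ 𝒴
        ((mlog (1 - hop.mkContinuous b hHop ∘L fderiv ℂ Dt B₀) : 𝒴 →L[ℂ] 𝒴) : 𝒴 →ₗ[ℂ] 𝒴)).re =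
      Real.log (LinearMap.det ((fderiv ℂ (fun B => B - hop (Dt B)) B₀ : 𝒴 →L[ℂ] 𝒴) : 𝒴 →ₗ[ℂ] 𝒴)).re := by
  rw [trace_logJacobian_eq_ofReal_log_det hC hCa hC₂ hb hHop hq2 hRC hDball hDfix hκX hκY hhop hCt hB₀ hreal,
    Complex.ofReal_re]

/-- **`Re det DΦ(B₀) = Real.exp (Re Tr log DΦ(B₀))`** at a real point — the positive Jacobian of the substitution in
the real integral (2.10) IS `exp` of the real number `Tr log DΦ(B₀)`, the form in which it enters (2.12). [folklore] -/
theorem re_det_jacobian_eq_exp (hC : QuadAnalytic Ct C₂ R) (hCa : AnalyticOnNhd ℂ Ct {Y : 𝒴 | ‖Y‖ < R})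
    (hC₂ : 0 ≤ C₂) (hb : 0 ≤ b) (hHop : ∀ X, ‖hop X‖ ≤ b * ‖X‖) (hq2 : 9 * C₂ * b * ε ≤ 1 / 2)
    (hRC : 3 * ε ≤ R) (hDball : ∀ B : 𝒴, ‖B‖ < ε → Dt B ∈ closedBall (0:𝒳) (4 * C₂ * ε ^ 2))
    (hDfix : ∀ B : 𝒴, ‖B‖ < ε → Ct (B - hop (Dt B)) = Dt B)
    (hκX : ∀ X, κX (κX X) = X) (hκY : ∀ B, κY (κY B) = B)
    (hhop : ∀ X, hop (κX X) = κY (hop X)) (hCt : ∀ Y : 𝒴, ‖Y‖ < R → Ct (κY Y) = κX (Ct Y))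
    {B₀ : 𝒴} (hB₀ : ‖B₀‖ < ε) (hreal : κY B₀ = B₀) :
    (LinearMap.det ((fderiv ℂ (fun B => B - hop (Dt B)) B₀ : 𝒴 →L[ℂ] 𝒴) : 𝒴 →ₗ[ℂ] 𝒴)).re =
      Real.exp (LinearMap.trace ℂ 𝒴
        ((mlog (1 - hop.mkContinuous b hHop ∘L fderiv ℂ Dt B₀) : 𝒴 →L[ℂ] 𝒴) : 𝒴 →ₗ[ℂ] 𝒴)).re := by
  rw [re_trace_logJacobian_eq_log_det hC hCa hC₂ hb hHop hq2 hRC hDball hDfix hκX hκY hhop hCt hB₀ hreal,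
    Real.exp_log (det_jacobian_pos hC hCa hC₂ hb hHop hq2 hRC hDball hDfix hκX hκY hhop hCt hB₀ hreal)]

end jacobian

/-! ## §3  Transcription of the (2.12) term at real fields -/
section transcription

variable {𝒳 𝒴 : Type*} [NormedAddCommGroup 𝒳] [NormedSpace ℂ 𝒳] [CompleteSpace 𝒳]
  [NormedAddCommGroup 𝒴] [NormedSpace ℂ 𝒴] [CompleteSpace 𝒴] [FiniteDimensional ℂ 𝒴]

/-- **B12 (2.12) p. 268 — the term «Tr log(I − h((δ/δB)D̃)(g_kCB))» at REAL («𝐠-valued», p. 267) fields.**  For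
the hypothesis-style `D̃` of `B12Lineariz267` (any `Dt` in the ball `4C₂ε²` solving `C̃(B − hD̃(B)) = D̃(B)` on
`‖B‖ < ε`), under the hypotheses of `B12JacobianTrLog268.p268_TrLog_jacobian_term_findim` (`𝒴` finite-dimensional,
`9C₂bε ≤ 1/2`) and the real structure of `B12JacobianReal267` (conjugations `κ_𝒳`, `κ_𝒴`; `h`, `C̃` equivariant), at
every real point `B₀` (`κB₀ = B₀`, `‖B₀‖ < ε`), with `J(B₀) = h∘DD̃(B₀)` and `log DΦ(B₀) = mlog (1 − J(B₀))`:
(i) `log DΦ(B₀)` commutes with the conjugation; (ii) `Tr log DΦ(B₀)` is REAL (`conj Tr = Tr`); (iii)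
`Tr log DΦ(B₀) = Real.log (det DΦ(B₀))` and (iv) `= Complex.log (det DΦ(B₀))` — the term of (2.12) is, on the nose,
the logarithm of the (real, positive) Jacobian determinant of the substitution `B′ = B − hD̃(B)` in the real
integral (2.10); (v) `det DΦ(B₀) = Real.exp (Tr log DΦ(B₀)) > 0`.  Everything about `D̃`, `C̃`, `h`, `κ` is a
HYPOTHESIS; nothing printed is asserted. [cite: Balaban1987RG1, (2.12) p.268] -/
theorem p268_TrLog_real {hop : 𝒳 →ₗ[ℂ] 𝒴} {Ct : 𝒴 → 𝒳} {C₂ R b ε : ℝ} {Dt : 𝒴 → 𝒳}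
    {κX : 𝒳 ≃ₗᵢ⋆[ℂ] 𝒳} {κY : 𝒴 ≃ₗᵢ⋆[ℂ] 𝒴}
    (hC : QuadAnalytic Ct C₂ R) (hCa : AnalyticOnNhd ℂ Ct {Y : 𝒴 | ‖Y‖ < R})
    (hC₂ : 0 ≤ C₂) (hb : 0 ≤ b) (hHop : ∀ X, ‖hop X‖ ≤ b * ‖X‖) (hq2 : 9 * C₂ * b * ε ≤ 1 / 2)
    (hRC : 3 * ε ≤ R) (hDball : ∀ B : 𝒴, ‖B‖ < ε → Dt B ∈ closedBall (0:𝒳) (4 * C₂ * ε ^ 2))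
    (hDfix : ∀ B : 𝒴, ‖B‖ < ε → Ct (B - hop (Dt B)) = Dt B)
    (hκX : ∀ X, κX (κX X) = X) (hκY : ∀ B, κY (κY B) = B)
    (hhop : ∀ X, hop (κX X) = κY (hop X)) (hCt : ∀ Y : 𝒴, ‖Y‖ < R → Ct (κY Y) = κX (Ct Y))
    {B₀ : 𝒴} (hB₀ : ‖B₀‖ < ε) (hreal : κY B₀ = B₀) :
    (∀ v, (mlog (1 - hop.mkContinuous b hHop ∘L fderiv ℂ Dt B₀)) (κY v) =
        κY ((mlog (1 - hop.mkContinuous b hHop ∘L fderiv ℂ Dt B₀)) v)) ∧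
    starRingEnd ℂ (LinearMap.trace ℂ 𝒴
        ((mlog (1 - hop.mkContinuous b hHop ∘L fderiv ℂ Dt B₀) : 𝒴 →L[ℂ] 𝒴) : 𝒴 →ₗ[ℂ] 𝒴)) =
      LinearMap.trace ℂ 𝒴 ((mlog (1 - hop.mkContinuous b hHop ∘L fderiv ℂ Dt B₀) : 𝒴 →L[ℂ] 𝒴) : 𝒴 →ₗ[ℂ] 𝒴) ∧
    LinearMap.trace ℂ 𝒴 ((mlog (1 - hop.mkContinuous b hHop ∘L fderiv ℂ Dt B₀) : 𝒴 →L[ℂ] 𝒴) : 𝒴 →ₗ[ℂ] 𝒴) =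
      ((Real.log (LinearMap.det
        ((fderiv ℂ (fun B => B - hop (Dt B)) B₀ : 𝒴 →L[ℂ] 𝒴) : 𝒴 →ₗ[ℂ] 𝒴)).re : ℝ) : ℂ) ∧
    LinearMap.trace ℂ 𝒴 ((mlog (1 - hop.mkContinuous b hHop ∘L fderiv ℂ Dt B₀) : 𝒴 →L[ℂ] 𝒴) : 𝒴 →ₗ[ℂ] 𝒴) =
      Complex.log (LinearMap.det ((fderiv ℂ (fun B => B - hop (Dt B)) B₀ : 𝒴 →L[ℂ] 𝒴) : 𝒴 →ₗ[ℂ] 𝒴)) ∧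
    ((LinearMap.det ((fderiv ℂ (fun B => B - hop (Dt B)) B₀ : 𝒴 →L[ℂ] 𝒴) : 𝒴 →ₗ[ℂ] 𝒴)).re =
      Real.exp (LinearMap.trace ℂ 𝒴
        ((mlog (1 - hop.mkContinuous b hHop ∘L fderiv ℂ Dt B₀) : 𝒴 →L[ℂ] 𝒴) : 𝒴 →ₗ[ℂ] 𝒴)).re ∧
     0 < (LinearMap.det ((fderiv ℂ (fun B => B - hop (Dt B)) B₀ : 𝒴 →L[ℂ] 𝒴) : 𝒴 →ₗ[ℂ] 𝒴)).re) :=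
  ⟨logJacobian_real hC hCa hC₂ hb hHop hq2 hRC hDball hDfix hκX hκY hhop hCt hB₀ hreal,
    conj_trace_logJacobian hC hCa hC₂ hb hHop hq2 hRC hDball hDfix hκX hκY hhop hCt hB₀ hreal,
    trace_logJacobian_eq_ofReal_log_det hC hCa hC₂ hb hHop hq2 hRC hDball hDfix hκX hκY hhop hCt hB₀ hreal,
    trace_logJacobian_eq_clog_det hC hCa hC₂ hb hHop hq2 hRC hDball hDfix hκX hκY hhop hCt hB₀ hreal,
    re_det_jacobian_eq_exp hC hCa hC₂ hb hHop hq2 hRC hDball hDfix hκX hκY hhop hCt hB₀ hreal,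
    det_jacobian_pos hC hCa hC₂ hb hHop hq2 hRC hDball hDfix hκX hκY hhop hCt hB₀ hreal⟩

/-- Non-vacuity of the hypothesis set: the degenerate model `𝒳 = 𝒴 = ℂ`, `κ_𝒳 = κ_𝒴 =` complex conjugation
(`starₗᵢ ℂ`), `h = id`, `C̃ = 0`, `D̃ = 0`, `C₂ = 0`, `R = 3`, `b = 1`, `ε = 1`, real point `B₀ = 1/2` satisfies every
hypothesis of `p268_TrLog_real` (there `J = 0`, `log DΦ = 0`, `det DΦ = 1`). -/
example : ∃ (hop : ℂ →ₗ[ℂ] ℂ) (Ct : ℂ → ℂ) (C₂ R b ε : ℝ) (Dt : ℂ → ℂ) (κX κY : ℂ ≃ₗᵢ⋆[ℂ] ℂ) (B₀ : ℂ),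
    QuadAnalytic Ct C₂ R ∧ AnalyticOnNhd ℂ Ct {Y : ℂ | ‖Y‖ < R} ∧ 0 ≤ C₂ ∧ 0 ≤ b ∧
    (∀ X, ‖hop X‖ ≤ b * ‖X‖) ∧ 9 * C₂ * b * ε ≤ 1 / 2 ∧ 3 * ε ≤ R ∧
    (∀ B : ℂ, ‖B‖ < ε → Dt B ∈ closedBall (0:ℂ) (4 * C₂ * ε ^ 2)) ∧
    (∀ B : ℂ, ‖B‖ < ε → Ct (B - hop (Dt B)) = Dt B) ∧
    (∀ X, κX (κX X) = X) ∧ (∀ B, κY (κY B) = B) ∧ (∀ X, hop (κX X) = κY (hop X)) ∧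
    (∀ Y : ℂ, ‖Y‖ < R → Ct (κY Y) = κX (Ct Y)) ∧ ‖B₀‖ < ε ∧ κY B₀ = B₀ := by
  refine ⟨LinearMap.id, fun _ => 0, 0, 3, 1, 1, fun _ => 0, starₗᵢ ℂ, starₗᵢ ℂ, (1/2 : ℝ),
    ⟨fun Y _ => by simp, fun P Q => ?_⟩, fun Y _ => analyticAt_const, le_rfl, zero_le_one, fun X => by simp,
    by norm_num, by norm_num, fun B _ => by simp, fun B _ => rfl, fun X => by simp, fun B => by simp,
    fun X => by simp, fun Y _ => by simp, ?_, ?_⟩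
  · exact differentiableOn_const 0
  · rw [Complex.norm_real]; norm_num
  · rw [starₗᵢ_apply]
    exact Complex.conj_ofReal _

end transcription

end Literature.MathematicalPhysics.QuantumFieldTheory.Balaban1983to89.B12TrLogReal268
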